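import Mathlib
import HarnessLib
import Summits.HubbardSuperconductivity.HubbardSuperconductivity.Theorems.KLProgrammeCooperVertexBlocks
import Summits.HubbardSuperconductivity.HubbardSuperconductivity.Theorems.KLProgrammeCooperVertexBlocksD4

/-!
# Route `KLProgramme` — D2 companion IV: sector carriers (`permRep`, `matrixOp`) are unitary `D₄`-carriers

Cell gate-hubbard-kl, seat p3.  For the §3 objects of `KLProgrammeCooperVertexBlocksDefs.lean` — the permutation representation
`permRep σ` of `D₄` on `ℓ²(ι)` induced by an index action `σ : D₄ →* Perm ι` (sector indices at one scale) and the operator `matrixOp K`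
of a matrix kernel — this file proves the three facts the Schur machinery (`KLProgrammeCooperVertexBlocksD4.lean`) and the block
comparison (`KLProgrammeCooperVertexBlocks.lean`; cf. `…Model.lean` for the torus carrier) ask for, so that Lemma E.4's per-scale sector arrays can be fed to C2 with NO
further representation-theoretic obligations:

* `permRep_apply`, `permRep_one`, `permRep_mul`, `inner_permRep` — `(ρ_g v)(i) = v(σ_g⁻¹ i)` is a unitary representation;
  `d4PermRep_eq_permRep` — the finite-volume torus carrier of §2 is the case `σ = d4SitePerm`;
* `matrixOp_comm` — a `σ`-covariant kernel (`K (σ_g i) (σ_g j) = K i j`) gives an operator commuting with `permRep σ`;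
* `matrixChannelInf_eq_formInf` — the channel bottoms `matrixChannelInf σ K χ` ARE `formInf` of the block operators (C2 applies), and
  `le_formInf_matrixOp` — a common lower bound of the five channel bottoms bounds the whole form (reassembly).

References: HOME/DECOMP.md v7 App. E (E1: sector arrays `V_j(q; θ̄, θ̄')`), HOME/p3/C2-LEAN-GUIDE.md §4.
-/

noncomputable section

namespace Summit.HubbardSuperconductivity.HubbardSuperconductivity.Theorems.CooperVertexBlocks

set_option linter.dupNamespace false -- summit = problem name (single-conjunct summit), D-0017

open scoped InnerProductSpace
open RCLike Literature.MathematicalPhysics.QuantumLattice Literature.Probability.LatticeModels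
open Summit.HubbardSuperconductivity.HubbardSuperconductivity.Theorems.CooperChannelRiccatiFlow

section PermCarrier

variable {ι : Type*} [Fintype ι] (σ : DihedralGroup 4 →* Equiv.Perm ι)

/-- `(ρ_g v)(i) = v(σ_g⁻¹ i)`. -/
theorem permRep_apply (g : DihedralGroup 4) (v : EuclideanSpace ℂ ι) (i : ι) :
    permRep σ g v i = v ((σ g).symm i) := by
  simp [permRep, LinearIsometryEquiv.piLpCongrLeft_apply, Equiv.piCongrLeft'_apply]

/-- `ρ_1 = 1`. -/
theorem permRep_one : permRep σ 1 = 1 := by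
  apply ContinuousLinearMap.ext
  intro v
  ext i
  rw [permRep_apply, map_one]
  rfl

/-- `ρ_{gh} = ρ_g ρ_h`. -/
theorem permRep_mul (g h : DihedralGroup 4) : permRep σ (g * h) = permRep σ g * permRep σ h := by
  apply ContinuousLinearMap.ext
  intro v
  ext i
  change permRep σ (g * h) v i = permRep σ g (permRep σ h v) i
  rw [permRep_apply, permRep_apply, permRep_apply, map_mul]
  rfl

/-- Each `ρ_g` is an isometry. -/
theorem norm_permRep_apply (g : DihedralGroup 4) (v : EuclideanSpace ℂ ι) : ‖permRep σ g v‖ = ‖v‖ :=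
  (LinearIsometryEquiv.piLpCongrLeft 2 ℂ ℂ (σ g)).norm_map v

/-- `ρ_g ρ_{g⁻¹} = 1`. -/
theorem permRep_mul_inv (g : DihedralGroup 4) : permRep σ g * permRep σ g⁻¹ = 1 := by
  rw [← permRep_mul, mul_inv_cancel, permRep_one]

/-- **`permRep σ` is unitary:** `⟪ρ_g x, y⟫ = ⟪x, ρ_{g⁻¹} y⟫`. -/
theorem inner_permRep (g : DihedralGroup 4) (x y : EuclideanSpace ℂ ι) :
    ⟪permRep σ g x, y⟫_ℂ = ⟪x, permRep σ g⁻¹ y⟫_ℂ := by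
  have hy : permRep σ g (permRep σ g⁻¹ y) = y := by
    have h := congrArg (fun S : EuclideanSpace ℂ ι →L[ℂ] EuclideanSpace ℂ ι => S y) (permRep_mul_inv σ g)
    exact h
  conv_lhs => rw [← hy]
  exact (LinearIsometryEquiv.piLpCongrLeft 2 ℂ ℂ (σ g)).inner_map_map x _

/-- The torus carrier of §2 is the case `σ = d4SitePerm`. -/
theorem d4PermRep_eq_permRep (L : ℕ) [NeZero L] : d4PermRep L = permRep (d4SitePerm (L := L)) := rfl

variable [DecidableEq ι]

/-- `(matrixOp K v)(i) = Σ_j K i j · v j`. -/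
theorem matrixOp_apply (K : Matrix ι ι ℂ) (v : EuclideanSpace ℂ ι) (i : ι) : matrixOp K v i = ∑ j, K i j * v j := rfl

/-- **A `σ`-covariant kernel commutes with the representation:** `K (σ_g i) (σ_g j) = K i j` for all `g, i, j` ⇒
`matrixOp K ρ_g = ρ_g matrixOp K`. -/
theorem matrixOp_comm {K : Matrix ι ι ℂ} (hcov : ∀ (g : DihedralGroup 4) (i j : ι), K (σ g i) (σ g j) = K i j)
    (g : DihedralGroup 4) : matrixOp K * permRep σ g = permRep σ g * matrixOp K := by
  apply ContinuousLinearMap.ext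
  intro v
  ext k
  change matrixOp K (permRep σ g v) k = permRep σ g (matrixOp K v) k
  rw [matrixOp_apply, permRep_apply, matrixOp_apply]
  simp_rw [permRep_apply]
  rw [← Equiv.sum_comp (σ g) (fun k' => K k k' * v ((σ g).symm k'))]
  refine Finset.sum_congr rfl fun j _ => ?_
  rw [Equiv.symm_apply_apply]
  congr 1
  conv_lhs => rw [← Equiv.apply_symm_apply (σ g) k]
  exact hcov g ((σ g).symm k) j

/-- A `σ`-covariant kernel leaves every channel subspace invariant. -/
theorem matrixOp_mapsTo {K : Matrix ι ι ℂ} (hcov : ∀ (g : DihedralGroup 4) (i j : ι), K (σ g i) (σ g j) = K i j)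
    (χ : D4Irrep) : ∀ v ∈ channelSubspace (permRep σ) χ, matrixOp K v ∈ channelSubspace (permRep σ) χ :=
  mapsTo_channelSubspace_of_comm (matrixOp_comm σ hcov)

/-- **C2 applies to sector arrays:** the channel bottom of a `σ`-covariant kernel IS `formInf` of its block operator. -/
theorem matrixChannelInf_eq_formInf {K : Matrix ι ι ℂ} (hcov : ∀ (g : DihedralGroup 4) (i j : ι), K (σ g i) (σ g j) = K i j)
    (χ : D4Irrep) :
    matrixChannelInf σ K χ = formInf (blockOp (permRep σ) χ (matrixOp K) (matrixOp_mapsTo σ hcov χ)) :=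
  (formInf_blockOp _ _).symm

/-- The channel top of a `σ`-covariant kernel is `formSup` of its block operator. -/
theorem matrixChannelSup_eq_formSup {K : Matrix ι ι ℂ} (hcov : ∀ (g : DihedralGroup 4) (i j : ι), K (σ g i) (σ g j) = K i j)
    (χ : D4Irrep) :
    matrixChannelSup σ K χ = formSup (blockOp (permRep σ) χ (matrixOp K) (matrixOp_mapsTo σ hcov χ)) :=
  (formSup_blockOp _ _).symm

/-- **Reassembly on a sector carrier:** a common lower bound of the five channel bottoms of a `σ`-covariant kernel bounds the
whole form from below. -/
theorem le_formInf_matrixOp [Nonempty ι] {K : Matrix ι ι ℂ}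
    (hcov : ∀ (g : DihedralGroup 4) (i j : ι), K (σ g i) (σ g j) = K i j) {c : ℝ} (hc : ∀ χ, c ≤ matrixChannelInf σ K χ) :
    c ≤ formInf (matrixOp K) := by
  refine le_formInf_of_forall_channel (permRep_mul σ) (permRep_one σ) (inner_permRep σ) (matrixOp_comm σ hcov)
    fun χ w hw hwχ => (hc χ).trans ?_
  -- the channel bottom is below the form at the unit vector `w` of the channel
  refine csInf_le ⟨-‖matrixOp K‖, ?_⟩ ⟨w, ⟨hw, hwχ⟩, rfl⟩
  rintro _ ⟨v, ⟨hv, -⟩, rfl⟩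
  exact neg_le_of_abs_le (abs_re_inner_apply_le_norm (matrixOp K) hv)

end PermCarrier

end Summit.HubbardSuperconductivity.HubbardSuperconductivity.Theorems.CooperVertexBlocks

end
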